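import Literature.Geometry.Lorentzian.KerrConvergence

/-!
# Route EIHFluxBalance — `InertialRecession`: locality of the extended metric deviation

Helper file for the crux `stmt-FinalStateConjecture-10166`
(`Summit.FinalStateConjecture.FinalStateConjecture.Theses.EIHFluxBalance.InertialRecession`).

One bookkeeping lemma used when a hole chart is manufactured from the lab chart `Φ` by
re-charting (`…Rechart.lean`): if, on an open neighbourhood `N` of `z` contained in both reference
domains, two reference forms agree and two chart maps pull the spacetime metric back to the same
bilinear forms, then the two extended deviations (`Spacetime.deviationExtend`) agree near `z` —
hence have the same iterated derivatives at `z`, so `Cᵏ` sup norms over late slabs of the new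
chart are dominated by those of `Φ`. (The general-background restriction / smoothness /
radiation-zone lemmas live in `…ChartCalculus.lean`.) [folklore]
-/

noncomputable section

open scoped Manifold ContDiff Topology
open Filter Set TopologicalSpace Literature.Geometry.Lorentzian

namespace Summit.FinalStateConjecture.FinalStateConjecture.Theorems

variable (𝓢 : Spacetime 4)

/-! ### Two charts with the same pulled-back metric near a point -/

/-- **Locality of the extended deviation.** If, on an open neighbourhood `N` of `z` contained in
both domains, two reference forms agree and two chart maps pull the metric back to the same
bilinear forms, then the two extended deviations agree near `z` (hence have the same iterated
derivatives at `z`). [folklore] -/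
theorem deviationExtend_eventuallyEq_of_pullbackBilin_eq {B₁ B₂ : ModelBackground}
    {Ψ₁ : B₁.domain → 𝓢.carrier} {Ψ₂ : B₂.domain → 𝓢.carrier} {N : Set E4} (hN : IsOpen N)
    {z : E4} (hz : z ∈ N) (h₁ : N ⊆ (B₁.domain : Set E4)) (h₂ : N ⊆ (B₂.domain : Set E4))
    (hb : ∀ y ∈ N, B₁.bilin y = B₂.bilin y)
    (hp : ∀ (y : E4) (hy : y ∈ N),
      (pullbackBilin (I := 𝓡 4) (I' := 𝓘(ℝ, E4)) Ψ₁ 𝓢.metric.val ⟨y, h₁ hy⟩ :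
          E4 →L[ℝ] E4 →L[ℝ] ℝ) =
        pullbackBilin (I := 𝓡 4) (I' := 𝓘(ℝ, E4)) Ψ₂ 𝓢.metric.val ⟨y, h₂ hy⟩) :
    𝓢.deviationExtend B₁ Ψ₁ =ᶠ[𝓝 z] 𝓢.deviationExtend B₂ Ψ₂ := by
  filter_upwards [hN.mem_nhds hz] with y hy
  rw [show 𝓢.deviationExtend B₁ Ψ₁ y = 𝓢.deviation B₁ Ψ₁ ⟨y, h₁ hy⟩ from
      𝓢.deviationExtend_coe B₁ Ψ₁ ⟨y, h₁ hy⟩,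
    show 𝓢.deviationExtend B₂ Ψ₂ y = 𝓢.deviation B₂ Ψ₂ ⟨y, h₂ hy⟩ from
      𝓢.deviationExtend_coe B₂ Ψ₂ ⟨y, h₂ hy⟩]
  exact congrArg₂ (fun P b : E4 →L[ℝ] E4 →L[ℝ] ℝ ↦ P - b) (hp y hy) (hb y hy)

end Summit.FinalStateConjecture.FinalStateConjecture.Theorems

end
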